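import Summits.BirchSwinnertonDyer.BirchSwinnertonDyer.Theorems.DefiniteThetaDerivedHeightCapIwasawaSerreMuLambda
import HarnessLib

/-!
# Finite-layer certificates for the order of vanishing: one coefficient of `L_f` of valuation `< e_n − k` forces `θ_n^{ac} ∉ I^{k+1}`

Route-independent `Theorems` file (cell `b2b-bsdres`, seat `b2b-bsdres-x10b`, gen 46), part 22 of the series «tower square root»
serving crux `DerivedHeightCap` (stmt-BirchSwinnertonDyer-18438, route DefiniteTheta); the statements are the EFFECTIVE form of part 21,
i.e. the shape of the route's finite-level certificates ("`θ_n ∉ J_n^{r+1}` is a computation in `ℤ_p[G_n]`", route DefiniteTheta, crux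
`DefiniteExactOrder`, BC5 rung). HONEST FRAMING: no curve asserted, no class closed, BSD not proved by any of this.

* §1 (abstract tower of parts 3/17, one level, no unboundedness needed) ★ `not_mem_augIdeal_pow_of_not_pow_dvd_coeff`: if `θ_n` is the
  image of `L` and `p^{e_n − k} ∤ coeff_k L`, then `θ_n ∉ I_n^{ρ}` for every `ρ > k`; `not_mem_augIdeal_pow_of_not_dvd_coeff` (a coefficient
  `coeff_k L ∉ pℤ_p` with `k < e_n` suffices); `not_dvd_coeff_lam` (`p ∤ L ⇒ coeff_{λ(L)} L` is a unit).
* §2 (Gross-point tower, `K` imaginary quadratic, every prime `p`) ★★ `thetaAc_not_mem_augIdeal_pow_lam_succ`: **`μ = 0` ⇒ `θ_n^{ac} ∉ I^{λ(L_f)+1}`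
  at every layer `n` with `p^{λ(L_f)+1} ∣ #Q_{n+1}`, in particular at the layer `n = λ(L_f) + 2`** (`#Q_{n+1} ≥ p^{n−1}`, part 14) — an
  explicit level at which the bound `ord_J θ^{ac} ≤ λ(L_f)` of part 21 is CERTIFIED by one finite computation.

## References
* [BertoliniDarmon1996] §2.12 ("`θ_n` vanishes to order `ρ`"); [BertoliniDarmon2005] §1.2 (18)–(21); [GreenbergVatsal2000] (1)–(2);
  [Washington1997] §7.1.
-/

noncomputable section

open scoped BigOperators Polynomial

-- D-0017: single-problem summit, the namespace repeats the problem name by design.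
set_option linter.dupNamespace false

namespace Summit.BirchSwinnertonDyer.BirchSwinnertonDyer.Theorems.TowerSqrt

open Literature.NumberTheory.EllipticCurves Literature.NumberTheory.EllipticCurves.QuadOrderTower NumberField
  Literature.NumberTheory.Automorphic Module
open Literature.NumberTheory.EllipticCurves.MuLambda (red lam)
open Summit.BirchSwinnertonDyer.BirchSwinnertonDyer.Theorems.DefmuSupersingularTheta (picRes_mem_torsionImage)

universe u

variable (p : ℕ) [hp : Fact p.Prime]

/-! ### §1 One level of an abstract tower: a coefficient of small valuation is a certificate -/

section Level

variable {G : Type*} [CommGroup G]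

/-- ★ **Certificate at one layer**: if `θ ∈ ℤ_p[G]` (`G` generated by `γ`, `#G = p^e`) is the image of `L ∈ ℤ_p⟦X⟧` and
`p^{e − k} ∤ coeff_k L`, then `θ ∉ I^ρ` for every `ρ > k` (part 16: `θ ∈ I^ρ` forces `L ≡ X^ρ Q (mod ω_e)`, whose low coefficients are
divisible by `p^{e−k}`). [cite: BertoliniDarmon2005, §1.2 (18)–(21)] -/
theorem not_mem_augIdeal_pow_of_not_pow_dvd_coeff [Finite G] (γ : G) (e : ℕ) (hγ : γ ^ (p ^ e) = 1)
    (hgen : ∀ g : G, ∃ k : ℕ, γ ^ k = g) (hcard : Nat.card G = p ^ e) {L : PowerSeries ℤ_[p]} {θ : MonoidAlgebra ℤ_[p] G}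
    (hL : ∀ R : ℤ_[p][X], ((1 + PowerSeries.X : PowerSeries ℤ_[p]) ^ p ^ e - 1) ∣ L - (R : PowerSeries ℤ_[p]) →
      (Polynomial.aeval (R := ℤ_[p]) (MonoidAlgebra.of ℤ_[p] _ γ - 1)) R = θ)
    {k : ℕ} (hk : ¬ (p : ℤ_[p]) ^ (e - k) ∣ PowerSeries.coeff k L) {ρ : ℕ} (hρ : k < ρ) :
    θ ∉ augIdeal ℤ_[p] G ^ ρ := by
  intro hθ
  obtain ⟨Q, hQ⟩ := exists_X_pow_mul_of_mem_augIdeal_pow p γ e hγ hgen hcard hL ρ hθ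
  have h1 := pow_dvd_coeff_of_omega_dvd p e k hQ
  rw [map_sub, PowerSeries.coeff_X_pow_mul', if_neg (not_le.mpr hρ), sub_zero] at h1
  exact hk h1

/-- A coefficient `coeff_k L ∉ pℤ_p` with `k < e` is such a certificate: then `θ ∉ I^ρ` for every `ρ > k`. [folklore] -/
theorem not_mem_augIdeal_pow_of_not_dvd_coeff [Finite G] (γ : G) (e : ℕ) (hγ : γ ^ (p ^ e) = 1)
    (hgen : ∀ g : G, ∃ k : ℕ, γ ^ k = g) (hcard : Nat.card G = p ^ e) {L : PowerSeries ℤ_[p]} {θ : MonoidAlgebra ℤ_[p] G}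
    (hL : ∀ R : ℤ_[p][X], ((1 + PowerSeries.X : PowerSeries ℤ_[p]) ^ p ^ e - 1) ∣ L - (R : PowerSeries ℤ_[p]) →
      (Polynomial.aeval (R := ℤ_[p]) (MonoidAlgebra.of ℤ_[p] _ γ - 1)) R = θ)
    {k : ℕ} (hk : ¬ (p : ℤ_[p]) ∣ PowerSeries.coeff k L) (hke : k < e) {ρ : ℕ} (hρ : k < ρ) :
    θ ∉ augIdeal ℤ_[p] G ^ ρ :=
  not_mem_augIdeal_pow_of_not_pow_dvd_coeff p γ e hγ hgen hcard hL
    (fun h => hk ((dvd_pow_self (p : ℤ_[p]) (by omega : e - k ≠ 0)).trans h)) hρ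

end Level

/-- **`p ∤ L ⇒ coeff_{λ(L)} L` is a unit** (`λ(L)` is the `X`-adic order of `L mod p`, part 21). [cite: GreenbergVatsal2000, p. 2–3, (1)–(2)] -/
theorem not_dvd_coeff_lam {L : IwasawaAlgebra p} (h : ¬ (PowerSeries.C (p : ℤ_[p]) : PowerSeries ℤ_[p]) ∣ L) :
    ¬ (p : ℤ_[p]) ∣ PowerSeries.coeff (lam L) L := by
  have hred : red L ≠ 0 := fun h0 => h ((red_eq_zero_iff_C_dvd p L).mp h0)
  have hc := PowerSeries.coeff_order hred
  rw [lam, pfree_eq_self_of_not_C_dvd p h]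
  intro hdvd
  apply hc
  rw [PowerSeries.coeff_map, IsLocalRing.residue_eq_zero_iff, PadicInt.maximalIdeal_eq_span_p, Ideal.mem_span_singleton]
  exact hdvd

/-! ### §2 The Gross-point tower: the layer `λ(L_f) + 2` certifies `ord_J θ^{ac} ≤ λ(L_f)` -/

variable {K : Type u} [Field K] [NumberField K] {Nplus Nminus : ℕ} {S : Brandt.XiSetup Nplus Nminus}
  (φ : Brandt.ClassSet S.O → ℤ) (α : ℤ_[p]ˣ) (T : GrossPointTower K S p)

-- see part 8
set_option synthInstance.maxHeartbeats 40000 in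
/-- ★★ **Effective certificate under `μ = 0`**: `K` imaginary quadratic, any prime `p`, `L` the Iwasawa power series of `θ^{ac}` (w.r.t. a
coherent generator system `d`, part 19). If `μ(θ^{ac}) = 0` then at EVERY layer `n` with `p^{λ(L)+1} ∣ #Q_{n+1}` the element `θ_n^{ac}`
does NOT lie in `I^{λ(L)+1}` (the coefficient `coeff_{λ(L)} L` is a unit, §1). [cite: BertoliniDarmon2005, §1.2 (18)–(21)] [cite: GreenbergVatsal2000, p. 2–3, (1)–(2)] -/
theorem thetaAc_not_mem_augIdeal_pow_lam_succ (hK : IsImaginaryQuadratic K)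
    (d : ∀ n : ℕ, ClassGroup (quadOrder K (p ^ (n + 1))))
    (hdres : ∀ n, picRes K (pow_dvd_pow p (n + 1).le_succ) (d (n + 1)) = d n)
    (hdgen : ∀ n (x : ClassGroup (quadOrder K (p ^ (n + 1)))), ∃ i : ℕ, x * (d n ^ i)⁻¹ ∈ torsionImage K p (n + 1))
    {L : PowerSeries ℤ_[p]}
    (hL : ∀ n (R : ℤ_[p][X]), ((1 + PowerSeries.X : PowerSeries ℤ_[p]) ^ Nat.card (AcLayerGroup K p (n + 1)) - 1) ∣
        L - (R : PowerSeries ℤ_[p]) →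
      (Polynomial.aeval (R := ℤ_[p]) (MonoidAlgebra.of ℤ_[p] _ (acProj K p (n + 1) (d n)) - 1)) R = T.thetaAc p φ α n)
    (hmu : T.HasMuZeroAc p φ α) (n : ℕ) (hn : p ^ (lam L + 1) ∣ Nat.card (AcLayerGroup K p (n + 1))) :
    T.thetaAc p φ α n ∉ augIdeal ℤ_[p] (AcLayerGroup K p (n + 1)) ^ (lam L + 1) := by
  classical
  -- local instances: keep the typeclass search for the quotients away from `IsCyclic.isMulCommutative`
  haveI : ∀ m : ℕ, IsMulCommutative (ClassGroup (quadOrder K (p ^ m))) := fun m => CommMagma.to_isCommutative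
  have hndvd : ¬ (PowerSeries.C (p : ℤ_[p]) : PowerSeries ℤ_[p]) ∣ L := (hasMuZeroAc_iff_not_C_dvd p φ α T hK d hdres hdgen hL).mp hmu
  -- the layer data at level n
  have hgen : ∀ q : AcLayerGroup K p (n + 1), ∃ k : ℕ, acProj K p (n + 1) (d n) ^ k = q := by
    intro q
    obtain ⟨x, rfl⟩ := QuotientGroup.mk'_surjective (torsionImage K p (n + 1)) q
    obtain ⟨i, hi⟩ := hdgen n x
    refine ⟨i, ?_⟩
    rw [← map_pow, QuotientGroup.mk'_apply, QuotientGroup.mk'_apply, QuotientGroup.eq]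
    have : (d n ^ i)⁻¹ * x = x * (d n ^ i)⁻¹ := mul_comm _ _
    rw [this]; exact hi
  haveI hfin : Finite (AcLayerGroup K p (n + 1)) := by
    haveI : Finite (ClassGroup (quadOrder K (p ^ (n + 1)))) := finite_classGroup (K := K) _
    exact Finite.of_surjective _ (QuotientGroup.mk'_surjective (torsionImage K p (n + 1)))
  obtain ⟨e, he, -⟩ := exists_natCard_acLayerGroup_eq_anyPrime p hK n
  have hγ : acProj K p (n + 1) (d n) ^ (p ^ e) = 1 := by rw [← he]; exact pow_card_eq_one'
  have hL' : ∀ R : ℤ_[p][X], ((1 + PowerSeries.X : PowerSeries ℤ_[p]) ^ p ^ e - 1) ∣ L - (R : PowerSeries ℤ_[p]) →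
      (Polynomial.aeval (R := ℤ_[p]) (MonoidAlgebra.of ℤ_[p] _ (acProj K p (n + 1) (d n)) - 1)) R = T.thetaAc p φ α n :=
    fun R hR => hL n R (he ▸ hR)
  have hke : lam L < e := by
    rw [he] at hn
    have := (Nat.pow_dvd_pow_iff_le_right hp.out.one_lt).mp hn
    omega
  exact not_mem_augIdeal_pow_of_not_dvd_coeff p (acProj K p (n + 1) (d n)) e hγ hgen he hL' (not_dvd_coeff_lam p hndvd) hke
    (Nat.lt_succ_self _)

-- see part 8
set_option synthInstance.maxHeartbeats 40000 in
/-- ★★ **The layer `λ(L_f) + 2` always certifies**: `#Q_{n+1} = p^{e_n}` with `n ≤ e_n + 1` (part 14), so `p^{λ+1} ∣ #Q_{λ+3}` and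
`θ_{λ+2}^{ac} ∉ I^{λ+1}`; consequently `ord_J θ^{ac} ≤ λ(L_f)` is witnessed by ONE finite computation at that layer.
[cite: BertoliniDarmon2005, §1.2 (18)–(21)] [cite: BertoliniDarmon1996, §2.12] -/
theorem thetaAc_lam_add_two_not_mem (hK : IsImaginaryQuadratic K)
    (d : ∀ n : ℕ, ClassGroup (quadOrder K (p ^ (n + 1))))
    (hdres : ∀ n, picRes K (pow_dvd_pow p (n + 1).le_succ) (d (n + 1)) = d n)
    (hdgen : ∀ n (x : ClassGroup (quadOrder K (p ^ (n + 1)))), ∃ i : ℕ, x * (d n ^ i)⁻¹ ∈ torsionImage K p (n + 1))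
    {L : PowerSeries ℤ_[p]}
    (hL : ∀ n (R : ℤ_[p][X]), ((1 + PowerSeries.X : PowerSeries ℤ_[p]) ^ Nat.card (AcLayerGroup K p (n + 1)) - 1) ∣
        L - (R : PowerSeries ℤ_[p]) →
      (Polynomial.aeval (R := ℤ_[p]) (MonoidAlgebra.of ℤ_[p] _ (acProj K p (n + 1) (d n)) - 1)) R = T.thetaAc p φ α n)
    (hmu : T.HasMuZeroAc p φ α) :
    T.thetaAc p φ α (lam L + 2) ∉ augIdeal ℤ_[p] (AcLayerGroup K p (lam L + 2 + 1)) ^ (lam L + 1) ∧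
      T.acOrderOfVanishing p φ α ≤ (lam L : ℕ∞) := by
  obtain ⟨e, he, hne⟩ := exists_natCard_acLayerGroup_eq_anyPrime p hK (lam L + 2)
  have hdvd : p ^ (lam L + 1) ∣ Nat.card (AcLayerGroup K p (lam L + 2 + 1)) := by
    rw [he]; exact pow_dvd_pow p (by omega)
  have h := thetaAc_not_mem_augIdeal_pow_lam_succ p φ α T hK d hdres hdgen hL hmu (lam L + 2) hdvd
  exact ⟨h, GrossPointTower.acOrderOfVanishing_le_of_not_mem (lam L + 2) h⟩

end Summit.BirchSwinnertonDyer.BirchSwinnertonDyer.Theorems.TowerSqrt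

end
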